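import Literature.NumberTheory.LFunctions.ThetaChainExtCheck
import Literature.NumberTheory.LFunctions.ThetaChainSound
import HarnessLib

/-!
# Schoenfeld's `θ`-bound by kernel computation beyond the table: soundness of the self-contained step
# (plan N2 of provefact `Literature.NumberTheory.LFunctions.robin_iff`, extension to `e¹⁶`)

Topic: `Literature/NumberTheory/LFunctions`. The semantic soundness of `ThetaChain.stepExt` /
`ThetaChain.runExt` (`ThetaChainExtCheck.lean`): the invariant `InvE` — the state's `p` is a prime
`> 599` with `Llo ≤ 2⁸⁰ log p ≤ Lhi`, `Tlo ≤ 2⁸⁰ θ(p) ≤ Thi`, the one-sided bounds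
`θ(p) − p ≤ B(p)`, `p − θ(p) ≤ B(p)` and `|θ(x) − x| ≤ B(x)` for all real `599 ≤ x < p`
(`B(x) = √x log² x/(8π)`, `ThetaChain.bnd`) — is preserved by every successful step, **whatever the
data** (`stepExt_inv`, `runExt_sound`, `runDExt_sound`): the step itself certifies that the new entry
`p'` is a prime (`primeChk₂_sound`) and that no prime lies strictly between `p` and `p'` (both odd,
the odd numbers between caught by `allOddComp_sound`, the even ones being `> 2`), so that `θ` is
constant on `[p, p')` and `θ(p') = θ(p) + log p'` (`ThetaChain.theta_real_eq`,
`ThetaChain.theta_succ_prime`); the two comparisons then give the inequality on `[p, p')` and at `p'`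
exactly as in `ThetaChain.step_inv`. `InvE.of_inv` starts the extended run from the final state of
the table run (`ThetaChain.Inv`), and `abs_theta_sub_le_of_invE` reads Schoenfeld's inequality on
`[599, P]` off a final state at `P`. Pure proof file apart from the `structure InvE`.

## References

* L. Schoenfeld, *Sharper bounds for the Chebyshev functions θ(x) and ψ(x). II*, Math. Comp. 30
  (1976), 337–360, Thm. 10 (6.3). [Schoenfeld1976]
-/

noncomputable section

namespace Literature.NumberTheory.LFunctions.ThetaChain

open ChainCheck ChainTable Real
open scoped Chebyshev

/-- **The invariant of the extended run** (no reference to any table). [folklore] -/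
structure InvE (s : TS) : Prop where
  /-- the number reached is prime -/
  prime : s.p.Prime
  /-- and exceeds `599` -/
  big : 599 < s.p
  /-- `Llo ≤ 2⁸⁰ log p` -/
  Llo_le : (s.Llo : ℝ) ≤ 2 ^ 80 * Real.log s.p
  /-- `2⁸⁰ log p ≤ Lhi` -/
  le_Lhi : 2 ^ 80 * Real.log s.p ≤ s.Lhi
  /-- `Tlo ≤ 2⁸⁰ θ(p)` -/
  Tlo_le : (s.Tlo : ℝ) ≤ 2 ^ 80 * θ (s.p : ℝ)
  /-- `2⁸⁰ θ(p) ≤ Thi` -/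
  le_Thi : 2 ^ 80 * θ (s.p : ℝ) ≤ s.Thi
  /-- `θ(p) − p ≤ B(p)` -/
  left : θ (s.p : ℝ) - s.p ≤ bnd s.p
  /-- `p − θ(p) ≤ B(p)` -/
  right : (s.p : ℝ) - θ (s.p : ℝ) ≤ bnd s.p
  /-- Schoenfeld's inequality below `p` -/
  sch : ∀ x : ℝ, 599 ≤ x → x < s.p → |θ x - x| ≤ bnd x

/-- The table invariant at a prime `> 599` gives the invariant of the extended run. [folklore] -/
theorem InvE.of_inv {s : TS} (h : Inv s) (hbig : 599 < s.p) : InvE s :=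
  ⟨h.prime, hbig, h.Llo_le, h.le_Lhi, h.Tlo_le, h.le_Thi, h.left hbig.le, h.right hbig, h.sch⟩

/-- **Soundness of one self-contained step.** [cite: Schoenfeld1976, Thm. 10 (6.3)] -/
theorem stepExt_inv {s s' : TS} (hI : InvE s) {p' : ℕ} (h : stepExt s p' = some s') : InvE s' := by
  obtain ⟨p, Llo, Lhi, Tlo, Thi⟩ := s
  obtain ⟨hprime, hbig, hLlo, hLhi, hTlo, hThi, hleft, hright, hsch⟩ := hI
  simp only at hprime hbig hLlo hLhi hTlo hThi hleft hright hsch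
  have hp1 : 1 ≤ p := hprime.one_lt.le
  have hp0 : 0 < p := hprime.pos
  -- unfold the step
  simp only [stepExt, Nat.mul_eq, Nat.sub_eq, Nat.add_eq] at h
  obtain ⟨hg1, h⟩ := bif_not_none h
  simp only [Bool.and_eq_true, Nat.blt_eq] at hg1
  obtain ⟨⟨⟨⟨hpp', hpodd⟩, hodd⟩, hchk⟩, hall⟩ := hg1
  have hpodd' : p % 2 = 1 := Nat.eq_of_beq_eq_true hpodd
  have hodd' : p' % 2 = 1 := Nat.eq_of_beq_eq_true hodd
  have hp'prime : p'.Prime := primeChk₂_sound hchk (Nat.odd_iff.2 hodd')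
  -- no prime strictly between `p` and `p'`
  have hnoprime : ∀ q : ℕ, p < q → q < p' → ¬ q.Prime := by
    intro q h1 h2 hq
    rcases hq.eq_two_or_odd' with rfl | ⟨j, hj⟩
    · omega
    · have hk : (q - (p + 2)) / 2 < (p' - p) / 2 - 1 := by omega
      have := allOddComp_sound _ _ hall ((q - (p + 2)) / 2) hk
      apply this
      rwa [show p + 2 + 2 * ((q - (p + 2)) / 2) = q by omega]
  obtain ⟨hg2, h⟩ := bif_not_none h
  rcases hln : logNext p Llo Lhi p' with _ | ⟨Llo', Lhi'⟩
  · rw [hln] at h; simp at h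
  · rw [hln] at h
    simp only at h
    obtain ⟨hg3, h⟩ := bif_not_none h
    simp only [Option.some.injEq] at h
    subst h
    obtain ⟨hLlo', hLhi'⟩ := logNext_sound hln hp0 hpp'.le hLlo hLhi
    have hθ' : θ (p' : ℝ) = θ (p : ℝ) + Real.log p' := theta_succ_prime hp'prime hpp' hnoprime
    have hθmono : θ (p : ℝ) ≤ θ (p' : ℝ) := Chebyshev.theta_mono (by exact_mod_cast hpp'.le)
    have hp1' : (1 : ℝ) ≤ p := by exact_mod_cast hp1
    have hpp'R : (p : ℝ) ≤ p' := by exact_mod_cast hpp'.le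
    -- the right-end check
    have hrightEnd : (p' : ℝ) - θ (p : ℝ) ≤ bnd p := by
      have hD := chkB_sound hg2 hp1 hLlo
      have h1 : (SC : ℝ) * p' - Tlo ≤ ((SC * p' - Tlo : ℕ) : ℝ) := by
        have := real_sub_le_natSub (SC * p') Tlo
        push_cast at this ⊢
        exact this
      rw [SC_real] at h1
      have h2 : 2 ^ 80 * ((p' : ℝ) - θ (p : ℝ)) ≤ 2 ^ 80 * bnd p := by
        unfold bnd; nlinarith
      exact le_of_mul_le_mul_left h2 (by positivity)
    -- the check at `p'`
    have hleftNew : θ (p' : ℝ) - p' ≤ bnd p' := by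
      have hD := chkB_sound hg3 (hp1.trans hpp'.le) hLlo'
      have h1 : ((Thi : ℝ) + Lhi') - SC * p' ≤ ((Thi + Lhi' - SC * p' : ℕ) : ℝ) := by
        have := real_sub_le_natSub (Thi + Lhi') (SC * p')
        push_cast at this ⊢
        exact this
      rw [SC_real] at h1
      have h2 : 2 ^ 80 * (θ (p' : ℝ) - p') ≤ 2 ^ 80 * bnd p' := by
        unfold bnd; rw [hθ']; nlinarith
      exact le_of_mul_le_mul_left h2 (by positivity)
    refine ⟨hp'prime, by simp only; omega, hLlo', hLhi', ?_, ?_, hleftNew, ?_, ?_⟩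
    · simp only; rw [hθ']; push_cast; linarith
    · simp only; rw [hθ']; push_cast; linarith
    · simp only
      have h2 : bnd p ≤ bnd p' := bnd_mono hp1' hpp'R
      linarith
    · intro x hx hxp'
      simp only at hxp'
      by_cases hxp : x < p
      · exact hsch x hx hxp
      · push Not at hxp
        exact abs_theta_sub_le_Ico hp1 hnoprime hleft hrightEnd hxp hxp'

/-- **Soundness of a run over arbitrary data.** [folklore] -/
theorem runExt_sound : ∀ (fuel : ℕ) {s s' : TS} (seg : List ℕ), InvE s →
    runExt fuel s seg = some s' → InvE s'
  | 0, s, s', _, hI, h => by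
      simp only [runExt, Option.some.injEq] at h
      exact h ▸ hI
  | fuel + 1, s, s', [], hI, h => by
      simp only [runExt, Option.some.injEq] at h
      exact h ▸ hI
  | fuel + 1, s, s', p' :: rest, hI, h => by
      simp only [runExt] at h
      rcases hst : stepExt s p' with _ | s₁
      · rw [hst] at h; simp at h
      · rw [hst] at h
        simp only at h
        exact runExt_sound fuel rest (stepExt_inv hI hst) h

/-- **Soundness of a chunk of the extended run.** [folklore] -/
theorem runDExt_sound {fuel k : ℕ} {s s' : TS} (hI : InvE s) (h : runDExt fuel k s = some s') :
    InvE s' :=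
  runExt_sound fuel _ hI h

/-- **Schoenfeld's inequality from a finished extended run**: `|θ(x) − x| ≤ √x log² x/(8π)` for all
real `599 ≤ x ≤ P`, `P` the prime of a state satisfying `InvE`. [cite: Schoenfeld1976, Thm. 10 (6.3)] -/
theorem abs_theta_sub_le_of_invE {s : TS} (hI : InvE s) {x : ℝ} (hx : 599 ≤ x) (hxP : x ≤ s.p) :
    |θ x - x| ≤ Real.sqrt x * Real.log x ^ 2 / (8 * Real.pi) := by
  rcases lt_or_eq_of_le hxP with hlt | heq
  · exact hI.sch x hx hlt
  · rw [heq, abs_sub_le_iff]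
    exact ⟨by have := hI.left; unfold bnd at this; linarith,
      by have := hI.right; unfold bnd at this; linarith⟩

end Literature.NumberTheory.LFunctions.ThetaChain

end
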